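import Summits.KontsevichZagierPeriods.KontsevichZagierPeriods.Theses.FermatIsogeny
import Summits.KontsevichZagierPeriods.KontsevichZagierPeriods.Theorems.FermatIsogenyBetaLinearSectorFermatLayer
import Summits.KontsevichZagierPeriods.KontsevichZagierPeriods.Theorems.FermatIsogenyBetaLinearSectorStubFermatSymbolData
import Summits.KontsevichZagierPeriods.KontsevichZagierPeriods.Theorems.FermatIsogenyBetaLinearSectorStubFermatIntegrand
import Summits.KontsevichZagierPeriods.KontsevichZagierPeriods.Theorems.FermatIsogenyBetaLinearSectorStubFermatRealise
import Summits.KontsevichZagierPeriods.KontsevichZagierPeriods.Theorems.FermatIsogenyBetaLinearSectorGreen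
import Literature.NumberTheory.Transcendental.CurvePeriods
import Literature.NumberTheory.Transcendental.KZCalculus

/-!
# `BetaLinearSector` (stmt-KontsevichZagierPeriods-3897) — THE FERMAT LAYER, CLOSED MODULO ITS SECTOR APEX

Line `fermat-sector-transport`: the three Fermat normalisation stubs (`stub_fermatSymbolData`, `stub_fermatIntegrand`,
`stub_fermatRealise`) and the four Green stubs are landed theorems; discharging the hypotheses of the implication-shaped
composition (`Theorems/FermatIsogenyBetaLinearSectorFermatLayer.lean`) BY NAME gives:

* `betaArcs` — UNCONDITIONAL: every beta cell `[c·t^{a-1}(1-t)^{b-1}]` (`a, b ∈ ℚ_{>0}`, `c` real algebraic) is, modulo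
  `M₁ = closure (1a ∪ 1b ∪ 2 ∪ Green)` (hence modulo `KZ.relations`, `M₁_le_relations`), the real realisation of ONE period symbol
  `(F_N, ω_{r,s}, γ_N)` on the affine Fermat curve `x^N + y^N = 1` (Rohrlich's form along the radial arc), with the same value —
  the improper Beta integral is a proper Fermat period INSIDE the calculus;
* `fermatLayer` — from Huber–Wüstholz 13.3 (2) RESTRICTED TO `ℚ̄`-COMBINATIONS OF FERMAT BETA-ARC SYMBOLS `(F_N, ω_{r,s}, γ_N)` (the
  sector apex `HWFermatArcs`, in print Wolfart–Wüstholz 1985 + Huber–Wüstholz's generation theorem), every `ℤ`-combination of beta cells with vanishing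
  value lies in `M₁`;
* `BetaLinearSector_of_huberWustholzFermatArcs` — **the crux from the sector apex alone** (HW 13.3 (2) for ℚ̄-combinations of
  Fermat beta-arc symbols = the Wolfart–Wüstholz 1985 setting; sharper than
  `BetaLinearSector_of_huberWustholzCurvePeriods`, which takes Huber–Wüstholz for all curves).

The sector apex is implied by the Literature named fact `HuberWustholzCurvePeriods`
(`huberWustholzFermatArcs_of_huberWustholzCurvePeriods`); it is the ONE open input of the line.

References: A. Huber, G. Wüstholz, *Transcendence and linear relations of 1-periods* (2022), Thm 13.3 (2); J. Wolfart,
G. Wüstholz, *Der Überlagerungsradius gewisser algebraischer Kurven und die Werte der Betafunktion an rationalen Stellen*,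
Math. Ann. 273 (1985); B. Gross (appendix by D. Rohrlich), Invent. Math. 45 (1978), §1; M. Kontsevich, D. Zagier, *Periods* (2001), §1.2.
-/

noncomputable section

namespace Summit.KontsevichZagierPeriods.FermatIsogeny.BetaLinearSector

open scoped BigOperators
open MeasureTheory Set MvPolynomial
open Literature.NumberTheory.Transcendental Literature.NumberTheory.Transcendental.CurvePeriods
open Literature.ModelTheory.ExponentialFields (IsSemialgebraic)
open Summit.KontsevichZagierPeriods.SymplecticScissors.RealOnePeriodRelationsNegative (greenSet M₁ H₁ crux_iff)
open Summit.KontsevichZagierPeriods.KontsevichZagierPeriods.Theses.FermatIsogeny (BetaLinearSector)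

-- Huber–Wüstholz 13.3 (2) restricted FURTHER to `ℚ̄`-combinations of FERMAT BETA-ARC SYMBOLS `(F_N, ω_{r,s}, γ_N)` (Rohrlich's
-- form along the radial arc between the cusps `(1,0)`, `(0,1)`): in print the setting of Wolfart–Wüstholz 1985 (periods, torsion
-- end points) — the weakest sector apex the layer needs.
set_option quotPrecheck false in
local notation "HWFermatArcs" =>
  (∀ C : PeriodSymbol →₀ ℂ, (∀ σ, IsAlgebraic ℚ (C σ)) →
    (∀ σ ∈ C.support, ∃ (N r s : ℕ) (hZ : (⟨2, 1, ![X 0 ^ N + X 1 ^ N - 1]⟩ : CurveData).IsSmoothAffineCurve)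
        (γ : CurvePath (⟨2, 1, ![X 0 ^ N + X 1 ^ N - 1]⟩ : CurveData))
        (hω : ∀ i, HasAlgCoeffs ((![X 0 ^ (r - 1) * X 1 ^ s, -(X 0 ^ r * X 1 ^ (s - 1))] :
          Fin 2 → MvPolynomial (Fin 2) ℂ) i)),
        1 ≤ N ∧ 1 ≤ r ∧ 1 ≤ s ∧
        (∀ t : ℝ, γ.toFun t = ![(((1 - t) * ((1 - t) ^ N + t ^ N) ^ (-(1:ℝ) / N) : ℝ) : ℂ),
          ((t * ((1 - t) ^ N + t ^ N) ^ (-(1:ℝ) / N) : ℝ) : ℂ)]) ∧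
        σ = ⟨(⟨2, 1, ![X 0 ^ N + X 1 ^ N - 1]⟩ : CurveData), hZ,
          (![X 0 ^ (r - 1) * X 1 ^ s, -(X 0 ^ r * X 1 ^ (s - 1))] : Fin 2 → MvPolynomial (Fin 2) ℂ), hω, γ⟩) →
      evalCombination C = 0 →
      ∃ (k : ℕ) (ρ : Fin k → (PeriodSymbol →₀ ℂ)) (a : Fin k → ℂ),
        (∀ l, IsElementaryRelation (ρ l)) ∧ (∀ l, IsAlgebraic ℚ (a l)) ∧ C = ∑ l, a l • ρ l)

-- The predicate "is a Fermat beta-arc symbol" (the support condition of `HWFermatArcs`).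
set_option quotPrecheck false in
local notation "IsBetaArcSymbol" =>
  (fun σ : PeriodSymbol => ∃ (N r s : ℕ) (hZ : (⟨2, 1, ![X 0 ^ N + X 1 ^ N - 1]⟩ : CurveData).IsSmoothAffineCurve)
        (γ : CurvePath (⟨2, 1, ![X 0 ^ N + X 1 ^ N - 1]⟩ : CurveData))
        (hω : ∀ i, HasAlgCoeffs ((![X 0 ^ (r - 1) * X 1 ^ s, -(X 0 ^ r * X 1 ^ (s - 1))] :
          Fin 2 → MvPolynomial (Fin 2) ℂ) i)),
        1 ≤ N ∧ 1 ≤ r ∧ 1 ≤ s ∧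
        (∀ t : ℝ, γ.toFun t = ![(((1 - t) * ((1 - t) ^ N + t ^ N) ^ (-(1:ℝ) / N) : ℝ) : ℂ),
          ((t * ((1 - t) ^ N + t ^ N) ^ (-(1:ℝ) / N) : ℝ) : ℂ)]) ∧
        σ = ⟨(⟨2, 1, ![X 0 ^ N + X 1 ^ N - 1]⟩ : CurveData), hZ,
          (![X 0 ^ (r - 1) * X 1 ^ s, -(X 0 ^ r * X 1 ^ (s - 1))] : Fin 2 → MvPolynomial (Fin 2) ℂ), hω, γ⟩)

-- The set of BETA CELLS: one-dimensional representations pinned on `(0,1)` as `c·t^{a-1}(1-t)^{b-1}` (`a, b` positive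
-- rationals, `c` real algebraic) — written inline.
set_option quotPrecheck false in
local notation "BetaCellSet" =>
  {ρ : KZ.IntegralRep 1 | ∃ (a b : ℚ) (c : ℝ), 0 < a ∧ 0 < b ∧ IsAlgebraic ℚ c ∧ ρ.domain = {x | x 0 ∈ Set.Ioo (0:ℝ) 1} ∧
    Set.EqOn ρ.integrand (fun x => c * (x 0) ^ ((a:ℝ) - 1) * (1 - x 0) ^ ((b:ℝ) - 1)) ρ.domain}

/-- **ARCS, unconditionally**: every beta cell is, modulo `M₁`, the real realisation of one Fermat period symbol with the same
value (`betaArcs_of` fed with the three landed Fermat stubs). [cite: HuberWustholz2022, §3.3.1] [cite: Gross1978, §1] -/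
theorem betaArcs : ∀ ρ : KZ.IntegralRep 1, ρ ∈ BetaCellSet →
    ∃ (C : PeriodSymbol →₀ ℂ) (R : PeriodSymbol → KZ.IntegralRep 1), (∀ σ, IsAlgebraic ℚ (C σ)) ∧
      (∀ σ ∈ C.support, IsBetaArcSymbol σ) ∧
      (∀ σ ∈ C.support, IsSemialgebraicMapOn ℚ {z : Fin 1 → ℝ | z 0 ∈ Set.Icc (0 : ℝ) 1}
        (fun z => Fin.append (fun i => (σ.γ.toFun (z 0) i).re) (fun i => (σ.γ.toFun (z 0) i).im))) ∧
      (∀ σ ∈ C.support, (R σ).domain = {z | z 0 ∈ Set.Ioo (0 : ℝ) 1} ∧ ∀ z ∈ (R σ).domain, (R σ).integrand z =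
        (C σ * ∑ i, MvPolynomial.eval (σ.γ.toFun (z 0)) (σ.ω i) * deriv (fun u => σ.γ.toFun u i) (z 0)).re) ∧
      evalCombination C = ((ρ.value : ℝ) : ℂ) ∧ KZ.of ρ - ∑ σ ∈ C.support, KZ.of (R σ) ∈ M₁ :=
  betaArcs_of stub_fermatSymbolData stub_fermatIntegrand stub_fermatRealise

/-- **THE FERMAT LAYER** (closed modulo the sector apex): from Huber–Wüstholz 13.3 (2) on Fermat beta-arc symbols, every `ℤ`-combination
of beta cells with vanishing value lies in `M₁`. [cite: HuberWustholz2022, Thm 13.3 (2)] -/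
theorem fermatLayer (hHW : HWFermatArcs) :
    ∀ c : KZ.FormalRep, c ∈ AddSubgroup.closure ((fun ρ : KZ.IntegralRep 1 => KZ.of ρ) '' BetaCellSet) →
      KZ.eval c = 0 → c ∈ M₁ :=
  Summit.KontsevichZagierPeriods.SymplecticScissors.RealOnePeriodRelations.SectorGlue.realOnePeriodRelations_of_sector
    ((fun ρ : KZ.IntegralRep 1 => KZ.of ρ) '' BetaCellSet) (· ∈ BetaCellSet) IsBetaArcSymbol hHW betaCells betaArcs

/-- **The crux from the SECTOR apex alone**: Huber–Wüstholz 13.3 (2) for `ℚ̄`-combinations of Fermat beta-arc symbols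
(the Wolfart–Wüstholz setting) implies `BetaLinearSector` (Green being landed: `greenInRelations`). CONDITIONAL on that one hypothesis, which the named fact
`HuberWustholzCurvePeriods` implies. [cite: HuberWustholz2022, Thm 13.3 (2)] -/
theorem BetaLinearSector_of_huberWustholzFermatArcs :
    (∀ C : PeriodSymbol →₀ ℂ, (∀ σ, IsAlgebraic ℚ (C σ)) → (∀ σ ∈ C.support, ∃ (N r s : ℕ) (hZ : (⟨2, 1, ![X 0 ^ N + X
    1 ^ N - 1]⟩ : CurveData).IsSmoothAffineCurve) (γ : CurvePath (⟨2, 1, ![X 0 ^ N + X 1 ^ N - 1]⟩ : CurveData)) (hω :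
    ∀ i, HasAlgCoeffs ((![X 0 ^ (r - 1) * X 1 ^ s, -(X 0 ^ r * X 1 ^ (s - 1))] : Fin 2 → MvPolynomial (Fin 2) ℂ) i)),
    1 ≤ N ∧ 1 ≤ r ∧ 1 ≤ s ∧ (∀ t : ℝ, γ.toFun t = ![(((1 - t) * ((1 - t) ^ N + t ^ N) ^ (-(1:ℝ) / N) : ℝ) : ℂ), ((t *
    ((1 - t) ^ N + t ^ N) ^ (-(1:ℝ) / N) : ℝ) : ℂ)]) ∧ σ = ⟨(⟨2, 1, ![X 0 ^ N + X 1 ^ N - 1]⟩ : CurveData), hZ, (![X 0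
    ^ (r - 1) * X 1 ^ s, -(X 0 ^ r * X 1 ^ (s - 1))] : Fin 2 → MvPolynomial (Fin 2) ℂ), hω, γ⟩) → evalCombination C =
    0 → ∃ (k : ℕ) (ρ : Fin k → (PeriodSymbol →₀ ℂ)) (a : Fin k → ℂ), (∀ l, IsElementaryRelation (ρ l)) ∧ (∀ l,
    IsAlgebraic ℚ (a l)) ∧ C = ∑ l, a l • ρ l) →
    Summit.KontsevichZagierPeriods.KontsevichZagierPeriods.Theses.FermatIsogeny.BetaLinearSector :=
  fun hHW => betaLinearSector_of_fermatLayer (fermatLayer hHW) greenInRelations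

end Summit.KontsevichZagierPeriods.FermatIsogeny.BetaLinearSector

end
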